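import Literature.Probability.Percolation.ZdFourArmFromFiveArm
import Literature.Probability.Percolation.PlanarDuality
import HarnessLib

/-!
# Kesten's well-separated five-arm event for critical bond percolation on `ℤ²` (definitions)

Topic `Literature/Probability/Percolation`; bond percolation on `ℤ² = Site 2` at `p = 1/2`
(`bondPercolation (zdGraph 2) half`). This file DEFINES the **well-separated (fenced) polychromatic
five-arm event** `zdFiveArmSep n N` of the square annulus `A_{n,N} = {n ≤ ‖·‖_∞ ≤ N}` — five arms
in the cyclic colour order open, closed, open, open, closed with PRESCRIBED, macroscopically
separated landing zones on both boundaries and Kesten's FENCES ("free spaces") at both ends of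
every arm — the event of Kesten's arm-separation theorem

  `c · P_{1/2}(𝒜₅(A_{n,N})) ≤ P_{1/2}(zdFiveArmSep n N)`  for `n₀ ≤ n`, `2n ≤ N`
  (`𝒜₅ = zdFiveArmClusters`, `ZdFourArmFromFiveArm.lean`; Kesten 1987, Lemma 4; Nolin 2008,
  Thm. 11 with §8.1; Duminil-Copin–Manolescu–Tassion 2021, Props. 6.2 and 6.5 at `q = 1`),

which is the input common to the two halves of the five-arm estimate `P_{1/2}(𝒜₅(A_{r,R})) ≍ (r/R)²`
that the tree does not have for bond percolation on `ℤ²` (it has Nolin's theorem for `j = 2` on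
the triangular lattice, `Nolin2008_twoArm_separation_holds`, `ArmSeparation*.lean`): the gluing
half `P(𝒜₅(m₁,m)) P(𝒜₅(m,n)) ≤ C P(𝒜₅(m₁,n))` of quasi-multiplicativity (Kesten 1987, Lemma 6;
Nolin 2008, Prop. 12 (ii) and Prop. 17; Duminil-Copin–Manolescu–Tassion 2021, Prop. 6.3) and the
point upper bound `N² P(𝒜₅(k,N)) ≤ C` (Kesten–Sidoravicius–Zhang 1998, (3.7), (3.12); Nolin 2008,
Thm. 24; its uniqueness step is `ZdFiveArmUniqueness.lean`), cf.
`DuminilCopinManolescuTassion2021_zdFiveArm_upperBound_of_pointBound_quasiMult`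
(`ZdFiveArmUpperBound.lean`).  The separation theorem itself is NOT vendored as a named fact here;
the theorems deducing these two halves from it take the displayed inequality as an explicit
hypothesis.

## The event (Nolin 2008, §4.2, Def. 6–8 of arXiv 0711.4948, at `η = η' = 1/64`; Kesten 1987, (2.26)–(2.28))

Scales: `√η N = N/8`, `η N = N/64`, `2√η N = N/4` (integer parts), and the same with `n` inside.
Layout (that of Kesten–Sidoravicius–Zhang's `F(w, n)` and of `zdFiveArmKSZ`): two OPEN arms `R⁺`,
`R⁻` landing on the right sides, one OPEN arm `L` landing on the left sides, two CLOSED dual arms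
`T`, `B` landing on the top and bottom sides; cyclically `R⁺ T L B R⁻` = open, closed, open,
closed, open.

* Landing zones (Def. 8: a landing sequence of size `η`: disjoint intervals of length `≥ η N`,
  pairwise and from the corners at distance `≥ 2√η N`; we take length exactly `η N`):
  outer `R⁺: {N} × [N/4, N/4 + N/64]`, `R⁻: {N} × [-N/4 - N/64, -N/4]`, `L: {-N} × [0, N/64]`,
  `T`: the faces just above the top side in the columns `[0, N/64]`, `B`: the faces just below the
  bottom side in the same columns; inner: the same picture on `∂Λ_n` (faces just inside).
* Bodies: an open arm is an open lattice walk inside `A_{n,N}` from its inner to its outer landing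
  zone; a closed dual arm is a walk of faces (lower-left corners, face adjacency = lattice adjacency,
  `PlanarDuality.lean`) each step of which crosses a CLOSED edge with both endpoints in `A_{n,N}`.
* Fences = free spaces (Def. 6; Kesten (2.28); KSZ (7.4)): at the outer endpoint `z = (N, t)` of a
  right arm, an open top–bottom crossing `V` of the box `[N+1, N+N/8] × [t-N/64, t+N/64]` and an
  open walk from `z` to a vertex of `V` inside the ball `{‖·-z‖_∞ < N/8}`; mirror images on the
  left; for a dual arm ending at the face `g` above the top side, a closed-dual left–right crossing
  of the face box `(columns g₀ ± N/64) × (rows N+1 … N+N/8)` and a closed-dual face walk from `g` to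
  it inside `{‖·-g‖_∞ < N/8}`; the same attached INSIDE `Λ_n` at every inner endpoint.  (As in
  Kesten's (2.28) — `[a¹ - √η 2^k, a¹ - 1]` — the fence boxes exclude the boundary line itself.)
* One disjointness clause: the two right arms `R⁺`, `R⁻` together with their four fences and
  attaching walks are vertex-disjoint (Kesten's separated arms of one colour belong to distinct
  crossing-clusters of the boundary strips).  Nothing else: `L` cannot meet `R^±` and the inner
  endpoints of `L`, `R^±` are not connected in the annulus BECAUSE of the two closed dual arms
  (`SqAnnulusDualBarrier.lean`), and open arms never use the closed edges the dual arms cross.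

The event is the intersection of an INCREASING event (the three fenced open arms,
`zdSepOpenPairR ∩ zdSepOpenArmL`) and a DECREASING one (the two fenced dual arms,
`zdSepDualArmT ∩ zdSepDualArmB`) — the shape required by the generalised FKG inequality used to
glue and extend separated arms (Nolin 2008, Lemma 13; `bondPercolation_locallyMonotone_fkg`).

## Faithfulness

* Kesten 1987 proves the separation theorem for a class of periodic planar models containing bond
  percolation on `ℤ²` (Nolin 2008, §8.1: "We can also handle bond percolation in this way. We
  refer the reader to the original paper of Kesten [Ke4] … where results are proved in this more
  general setting"); Nolin's Thm. 11 is its formulation with landing sequences, uniform over all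
  landing sequences of size `≥ η₀` — whence fixed zones of length `η N` and fixed `η = 1/64` here;
  Duminil-Copin–Manolescu–Tassion 2021, Props. 6.2 and 6.5 print well-separation and localization
  for the random-cluster model with `1 ≤ q < 4` on `ℤ²`, `q = 1` being Bernoulli bond percolation.
* The left-hand side is the tree's cluster-form five-arm event `zdFiveArmClusters` (two open
  crossings in distinct annulus-clusters and a third open crossing edge-disjoint from them), which
  contains the printed event "five disjoint arms" and is what the five-arm estimates of the tree
  are about; the right-hand side asks the two right arms to be vertex-disjoint, as printed.
* The theorem is used downstream only through its lower bound `≳`, for `p = 1/2`, `2n ≤ N` and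
  `n ≥ n₀` (small inner squares carry no landing zone of size `η`).

## References

* H. Kesten, *Scaling relations for 2D-percolation*, Comm. Math. Phys. 109 (1987), 109–156, §2:
  (2.26)–(2.28) (fences), Lemma 2, Lemma 4, Corollary 3, Lemma 6 [KestenScalingCMP1987] (not held;
  read through the restatements of KSZ 1998, App. §7, and Higuchi–Takei–Zhang 2012, §4).
* H. Kesten, V. Sidoravicius, Y. Zhang, *Almost all words are seen in critical site percolation on
  the triangular lattice*, Electron. J. Probab. 3 (1998), Lemma 5 and Appendix §7, (7.2)–(7.10)
  [KestenSidoraviciusZhang1998].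
* P. Nolin, *Near-critical percolation in two dimensions*, Electron. J. Probab. 13 (2008), §4.2
  (Def. 6–8 of arXiv 0711.4948), Thm. 11, Prop. 12, Lemma 13 [arXiv: Thm. 10, Prop. 11, Lemma 12],
  §8.1 (other lattices, bond percolation) [Nolin2008].
* H. Duminil-Copin, I. Manolescu, V. Tassion, *Planar random-cluster model: fractal properties of
  the critical phase*, PTRF 181 (2021), §6.2, Def. 6.1, Props. 6.2, 6.3, 6.5
  [DuminilCopinManolescuTassion2021].
* Y. Higuchi, M. Takei, Y. Zhang, *Scaling relations for two-dimensional Ising percolation*,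
  J. Stat. Phys. 148 (2012), §4 "Fence argument" (arXiv 1010.1586) [HiguchiTakeiZhang2012].

Tree: `zdFiveArmClusters`, `siteSphere`, `sqAnnulus`, `sqAnnulusOpenCrossing`
(`ZdFourArmFromFiveArm.lean`, `FourArmGarban.lean`), `sepEdge` (`PlanarDuality.lean`),
`bondPercolation`, `half`, `BondConfig`. Mathlib: `SimpleGraph.Walk`.
-/

noncomputable section

open MeasureTheory Set

namespace Literature.Probability.Percolation

open LatticeModels

/-! ### One fenced open arm -/

/-- **A fenced open arm landing on the right sides** of `A_{n,N}`, with inner landing heights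
`[lo, hi]` on `{x₀ = n}` and outer landing heights `[lo', hi']` on `{x₀ = N}`: the body `W` (an open
walk of the annulus from `x = (n, ·)` to `z = (N, ·)`), the outer fence (an open crossing `V` of
`[N+1, N+N/8] × [z₁ - N/64, z₁ + N/64]` from its bottom row to its top row, and an open walk `P`
from `z` to a vertex of `V` inside `{‖· - z‖_∞ < N/8}`) and the inner fence (an open crossing `V'`
of `[n - n/8, n-1] × [x₁ - n/64, x₁ + n/64]` from bottom to top and an open walk `P'` from `x` to a
vertex of `V'` inside `{‖· - x‖_∞ < n/8}`).  (Nolin 2008, Def. 6 of arXiv 0711.4948 with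
`η = 1/64`; Kesten 1987, (2.28); KSZ 1998, (7.4).) [cite: Nolin2008, §4.2 (arXiv 0711.4948 Def. 6–8: free spaces, landing sequences)] -/
structure ZdSepOpenArmR (ω : BondConfig (Site 2)) (n N : ℕ) (lo hi lo' hi' : ℤ) where
  /-- inner endpoint -/
  x : Site 2
  /-- outer endpoint -/
  z : Site 2
  /-- the body -/
  W : (zdGraph 2).Walk x z
  hx : x 0 = n ∧ lo ≤ x 1 ∧ x 1 ≤ hi
  hz : z 0 = N ∧ lo' ≤ z 1 ∧ z 1 ≤ hi'
  hW : ∀ v ∈ W.support, v ∈ sqAnnulus n N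
  hWo : ∀ e ∈ W.edges, e ∈ ω
  /-- bottom end of the outer fence crossing -/
  a : Site 2
  /-- top end of the outer fence crossing -/
  b : Site 2
  /-- attaching vertex on the outer fence crossing -/
  u : Site 2
  /-- the outer fence crossing -/
  V : (zdGraph 2).Walk a b
  /-- the outer attaching walk -/
  P : (zdGraph 2).Walk z u
  hab : a 1 = z 1 - (N / 64 : ℕ) ∧ b 1 = z 1 + (N / 64 : ℕ)
  hV : ∀ v ∈ V.support, (N : ℤ) + 1 ≤ v 0 ∧ v 0 ≤ N + (N / 8 : ℕ) ∧ |v 1 - z 1| ≤ (N / 64 : ℕ)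
  hVo : ∀ e ∈ V.edges, e ∈ ω
  hu : u ∈ V.support
  hP : ∀ v ∈ P.support, |v 0 - z 0| + 1 ≤ (N / 8 : ℕ) ∧ |v 1 - z 1| + 1 ≤ (N / 8 : ℕ)
  hPo : ∀ e ∈ P.edges, e ∈ ω
  /-- bottom end of the inner fence crossing -/
  a' : Site 2
  /-- top end of the inner fence crossing -/
  b' : Site 2
  /-- attaching vertex on the inner fence crossing -/
  u' : Site 2
  /-- the inner fence crossing -/
  V' : (zdGraph 2).Walk a' b'
  /-- the inner attaching walk -/
  P' : (zdGraph 2).Walk x u'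
  hab' : a' 1 = x 1 - (n / 64 : ℕ) ∧ b' 1 = x 1 + (n / 64 : ℕ)
  hV' : ∀ v ∈ V'.support, (n : ℤ) - (n / 8 : ℕ) ≤ v 0 ∧ v 0 + 1 ≤ n ∧ |v 1 - x 1| ≤ (n / 64 : ℕ)
  hV'o : ∀ e ∈ V'.edges, e ∈ ω
  hu' : u' ∈ V'.support
  hP' : ∀ v ∈ P'.support, |v 0 - x 0| + 1 ≤ (n / 8 : ℕ) ∧ |v 1 - x 1| + 1 ≤ (n / 8 : ℕ)
  hP'o : ∀ e ∈ P'.edges, e ∈ ω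

/-- **A fenced open arm landing on the left sides** (mirror image of `ZdSepOpenArmR`: body from
`x = (-n, ·)` to `z = (-N, ·)`, outer fence box `[-N-N/8, -N-1] × [z₁ ± N/64]`, inner fence box
`[-n+1, -n+n/8] × [x₁ ± n/64]`). [cite: Nolin2008, §4.2 (arXiv 0711.4948 Def. 6–8)] -/
structure ZdSepOpenArmL (ω : BondConfig (Site 2)) (n N : ℕ) (lo hi lo' hi' : ℤ) where
  /-- inner endpoint -/
  x : Site 2
  /-- outer endpoint -/
  z : Site 2
  /-- the body -/
  W : (zdGraph 2).Walk x z
  hx : x 0 = -(n : ℤ) ∧ lo ≤ x 1 ∧ x 1 ≤ hi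
  hz : z 0 = -(N : ℤ) ∧ lo' ≤ z 1 ∧ z 1 ≤ hi'
  hW : ∀ v ∈ W.support, v ∈ sqAnnulus n N
  hWo : ∀ e ∈ W.edges, e ∈ ω
  /-- bottom end of the outer fence crossing -/
  a : Site 2
  /-- top end of the outer fence crossing -/
  b : Site 2
  /-- attaching vertex on the outer fence crossing -/
  u : Site 2
  /-- the outer fence crossing -/
  V : (zdGraph 2).Walk a b
  /-- the outer attaching walk -/
  P : (zdGraph 2).Walk z u
  hab : a 1 = z 1 - (N / 64 : ℕ) ∧ b 1 = z 1 + (N / 64 : ℕ)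
  hV : ∀ v ∈ V.support, -((N : ℤ) + (N / 8 : ℕ)) ≤ v 0 ∧ v 0 + 1 ≤ -(N : ℤ) ∧ |v 1 - z 1| ≤ (N / 64 : ℕ)
  hVo : ∀ e ∈ V.edges, e ∈ ω
  hu : u ∈ V.support
  hP : ∀ v ∈ P.support, |v 0 - z 0| + 1 ≤ (N / 8 : ℕ) ∧ |v 1 - z 1| + 1 ≤ (N / 8 : ℕ)
  hPo : ∀ e ∈ P.edges, e ∈ ω
  /-- bottom end of the inner fence crossing -/
  a' : Site 2
  /-- top end of the inner fence crossing -/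
  b' : Site 2
  /-- attaching vertex on the inner fence crossing -/
  u' : Site 2
  /-- the inner fence crossing -/
  V' : (zdGraph 2).Walk a' b'
  /-- the inner attaching walk -/
  P' : (zdGraph 2).Walk x u'
  hab' : a' 1 = x 1 - (n / 64 : ℕ) ∧ b' 1 = x 1 + (n / 64 : ℕ)
  hV' : ∀ v ∈ V'.support, -(n : ℤ) + 1 ≤ v 0 ∧ v 0 ≤ -(n : ℤ) + (n / 8 : ℕ) ∧ |v 1 - x 1| ≤ (n / 64 : ℕ)
  hV'o : ∀ e ∈ V'.edges, e ∈ ω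
  hu' : u' ∈ V'.support
  hP' : ∀ v ∈ P'.support, |v 0 - x 0| + 1 ≤ (n / 8 : ℕ) ∧ |v 1 - x 1| + 1 ≤ (n / 8 : ℕ)
  hP'o : ∀ e ∈ P'.edges, e ∈ ω

/-! ### One fenced closed dual arm -/

/-- **A fenced closed dual arm landing on the top sides**: the body is a walk of faces `Q` from the
face `f = (f₀, n-1)` just inside the inner top side, `lo ≤ f₀ ≤ hi`, to the face `g = (g₀, N)` just
outside the outer top side, `lo' ≤ g₀ ≤ hi'`, each step of which crosses a CLOSED edge with both
endpoints in `A_{n,N}`; the outer fence is a walk of faces `C` inside the face box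
`(columns g₀ ± N/64) × (rows N+1 … N+N/8)` from its left column to its right column crossing
closed edges only, with a walk of faces `P` from `g` to a face of `C` inside `{‖· - g‖_∞ < N/8}`
crossing closed edges only; the inner fence is the same picture hanging below `f` inside `Λ_n`
(rows `n-1-n/8 … n-2`). [cite: Nolin2008, §4.2 (arXiv 0711.4948 Def. 6–8, free spaces for the dual colour)] -/
structure ZdSepDualArmT (ω : BondConfig (Site 2)) (n N : ℕ) (lo hi lo' hi' : ℤ) where
  /-- start face (inside) -/
  f : Site 2
  /-- end face (outside) -/
  g : Site 2
  /-- the body -/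
  Q : (zdGraph 2).Walk f g
  hf : f 1 + 1 = n ∧ lo ≤ f 0 ∧ f 0 ≤ hi
  hg : g 1 = N ∧ lo' ≤ g 0 ∧ g 0 ≤ hi'
  hQc : ∀ d ∈ Q.darts, sepEdge d.fst d.snd ∉ ω
  hQa : ∀ d ∈ Q.darts, ∀ v ∈ sepEdge d.fst d.snd, v ∈ sqAnnulus n N
  /-- left end of the outer fence crossing -/
  a : Site 2
  /-- right end of the outer fence crossing -/
  b : Site 2
  /-- attaching face on the outer fence crossing -/
  u : Site 2
  /-- the outer fence crossing -/
  C : (zdGraph 2).Walk a b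
  /-- the outer attaching walk -/
  P : (zdGraph 2).Walk g u
  hab : a 0 = g 0 - (N / 64 : ℕ) ∧ b 0 = g 0 + (N / 64 : ℕ)
  hC : ∀ w ∈ C.support, |w 0 - g 0| ≤ (N / 64 : ℕ) ∧ (N : ℤ) + 1 ≤ w 1 ∧ w 1 ≤ N + (N / 8 : ℕ)
  hCc : ∀ d ∈ C.darts, sepEdge d.fst d.snd ∉ ω
  hu : u ∈ C.support
  hP : ∀ w ∈ P.support, |w 0 - g 0| + 1 ≤ (N / 8 : ℕ) ∧ |w 1 - g 1| + 1 ≤ (N / 8 : ℕ)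
  hPc : ∀ d ∈ P.darts, sepEdge d.fst d.snd ∉ ω
  /-- left end of the inner fence crossing -/
  a' : Site 2
  /-- right end of the inner fence crossing -/
  b' : Site 2
  /-- attaching face on the inner fence crossing -/
  u' : Site 2
  /-- the inner fence crossing -/
  C' : (zdGraph 2).Walk a' b'
  /-- the inner attaching walk -/
  P' : (zdGraph 2).Walk f u'
  hab' : a' 0 = f 0 - (n / 64 : ℕ) ∧ b' 0 = f 0 + (n / 64 : ℕ)
  hC' : ∀ w ∈ C'.support, |w 0 - f 0| ≤ (n / 64 : ℕ) ∧ (n : ℤ) - 1 - (n / 8 : ℕ) ≤ w 1 ∧ w 1 + 2 ≤ n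
  hC'c : ∀ d ∈ C'.darts, sepEdge d.fst d.snd ∉ ω
  hu' : u' ∈ C'.support
  hP' : ∀ w ∈ P'.support, |w 0 - f 0| + 1 ≤ (n / 8 : ℕ) ∧ |w 1 - f 1| + 1 ≤ (n / 8 : ℕ)
  hP'c : ∀ d ∈ P'.darts, sepEdge d.fst d.snd ∉ ω

/-- **A fenced closed dual arm landing on the bottom sides** (mirror image of `ZdSepDualArmT`
under `x₁ ↦ -x₁`, faces `(f₀, f₁) ↦ (f₀, -1-f₁)`: body from the face `f = (f₀, -n)` just inside the
inner bottom side to the face `g = (g₀, -N-1)` just outside the outer bottom side; outer fence in the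
face rows `-N-1-N/8 … -N-2`, inner fence in the face rows `-n+1 … -n+n/8`). [cite: Nolin2008, §4.2 (arXiv 0711.4948 Def. 6–8)] -/
structure ZdSepDualArmB (ω : BondConfig (Site 2)) (n N : ℕ) (lo hi lo' hi' : ℤ) where
  /-- start face (inside) -/
  f : Site 2
  /-- end face (outside) -/
  g : Site 2
  /-- the body -/
  Q : (zdGraph 2).Walk f g
  hf : f 1 = -(n : ℤ) ∧ lo ≤ f 0 ∧ f 0 ≤ hi
  hg : g 1 + 1 = -(N : ℤ) ∧ lo' ≤ g 0 ∧ g 0 ≤ hi'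
  hQc : ∀ d ∈ Q.darts, sepEdge d.fst d.snd ∉ ω
  hQa : ∀ d ∈ Q.darts, ∀ v ∈ sepEdge d.fst d.snd, v ∈ sqAnnulus n N
  /-- left end of the outer fence crossing -/
  a : Site 2
  /-- right end of the outer fence crossing -/
  b : Site 2
  /-- attaching face on the outer fence crossing -/
  u : Site 2
  /-- the outer fence crossing -/
  C : (zdGraph 2).Walk a b
  /-- the outer attaching walk -/
  P : (zdGraph 2).Walk g u
  hab : a 0 = g 0 - (N / 64 : ℕ) ∧ b 0 = g 0 + (N / 64 : ℕ)
  hC : ∀ w ∈ C.support, |w 0 - g 0| ≤ (N / 64 : ℕ) ∧ -((N : ℤ) + 1 + (N / 8 : ℕ)) ≤ w 1 ∧ w 1 + 2 ≤ -(N : ℤ)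
  hCc : ∀ d ∈ C.darts, sepEdge d.fst d.snd ∉ ω
  hu : u ∈ C.support
  hP : ∀ w ∈ P.support, |w 0 - g 0| + 1 ≤ (N / 8 : ℕ) ∧ |w 1 - g 1| + 1 ≤ (N / 8 : ℕ)
  hPc : ∀ d ∈ P.darts, sepEdge d.fst d.snd ∉ ω
  /-- left end of the inner fence crossing -/
  a' : Site 2
  /-- right end of the inner fence crossing -/
  b' : Site 2
  /-- attaching face on the inner fence crossing -/
  u' : Site 2
  /-- the inner fence crossing -/
  C' : (zdGraph 2).Walk a' b'
  /-- the inner attaching walk -/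
  P' : (zdGraph 2).Walk f u'
  hab' : a' 0 = f 0 - (n / 64 : ℕ) ∧ b' 0 = f 0 + (n / 64 : ℕ)
  hC' : ∀ w ∈ C'.support, |w 0 - f 0| ≤ (n / 64 : ℕ) ∧ -(n : ℤ) + 1 ≤ w 1 ∧ w 1 ≤ -(n : ℤ) + (n / 8 : ℕ)
  hC'c : ∀ d ∈ C'.darts, sepEdge d.fst d.snd ∉ ω
  hu' : u' ∈ C'.support
  hP' : ∀ w ∈ P'.support, |w 0 - f 0| + 1 ≤ (n / 8 : ℕ) ∧ |w 1 - f 1| + 1 ≤ (n / 8 : ℕ)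
  hP'c : ∀ d ∈ P'.darts, sepEdge d.fst d.snd ∉ ω

/-! ### Carriers and the events -/

namespace ZdSepOpenArmR

variable {ω : BondConfig (Site 2)} {n N : ℕ} {lo hi lo' hi' : ℤ}

/-- The sites used by a fenced right arm: body, two fence crossings, two attaching walks. [folklore] -/
def carrier (A : ZdSepOpenArmR ω n N lo hi lo' hi') : Set (Site 2) :=
  {v | v ∈ A.W.support ∨ v ∈ A.V.support ∨ v ∈ A.P.support ∨ v ∈ A.V'.support ∨ v ∈ A.P'.support}

/-- A fenced right arm of `ω` is a fenced right arm of every larger configuration, with the same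
carrier. [folklore] -/
def mono (A : ZdSepOpenArmR ω n N lo hi lo' hi') {ω' : BondConfig (Site 2)} (h : ω ⊆ ω') :
    ZdSepOpenArmR ω' n N lo hi lo' hi' where
  x := A.x
  z := A.z
  W := A.W
  hx := A.hx
  hz := A.hz
  hW := A.hW
  hWo e he := h (A.hWo e he)
  a := A.a
  b := A.b
  u := A.u
  V := A.V
  P := A.P
  hab := A.hab
  hV := A.hV
  hVo e he := h (A.hVo e he)
  hu := A.hu
  hP := A.hP
  hPo e he := h (A.hPo e he)
  a' := A.a'
  b' := A.b'
  u' := A.u'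
  V' := A.V'
  P' := A.P'
  hab' := A.hab'
  hV' := A.hV'
  hV'o e he := h (A.hV'o e he)
  hu' := A.hu'
  hP' := A.hP'
  hP'o e he := h (A.hP'o e he)

/-- `mono` does not change the carrier. [folklore] -/
@[simp] theorem carrier_mono (A : ZdSepOpenArmR ω n N lo hi lo' hi') {ω' : BondConfig (Site 2)}
    (h : ω ⊆ ω') : (A.mono h).carrier = A.carrier := rfl

end ZdSepOpenArmR

namespace ZdSepOpenArmL

variable {ω : BondConfig (Site 2)} {n N : ℕ} {lo hi lo' hi' : ℤ}

/-- A fenced left arm of `ω` is a fenced left arm of every larger configuration. [folklore] -/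
def mono (A : ZdSepOpenArmL ω n N lo hi lo' hi') {ω' : BondConfig (Site 2)} (h : ω ⊆ ω') :
    ZdSepOpenArmL ω' n N lo hi lo' hi' where
  x := A.x
  z := A.z
  W := A.W
  hx := A.hx
  hz := A.hz
  hW := A.hW
  hWo e he := h (A.hWo e he)
  a := A.a
  b := A.b
  u := A.u
  V := A.V
  P := A.P
  hab := A.hab
  hV := A.hV
  hVo e he := h (A.hVo e he)
  hu := A.hu
  hP := A.hP
  hPo e he := h (A.hPo e he)
  a' := A.a'
  b' := A.b'
  u' := A.u'
  V' := A.V'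
  P' := A.P'
  hab' := A.hab'
  hV' := A.hV'
  hV'o e he := h (A.hV'o e he)
  hu' := A.hu'
  hP' := A.hP'
  hP'o e he := h (A.hP'o e he)

end ZdSepOpenArmL

namespace ZdSepDualArmT

variable {ω : BondConfig (Site 2)} {n N : ℕ} {lo hi lo' hi' : ℤ}

/-- A fenced top dual arm of `ω` is a fenced top dual arm of every smaller configuration. [folklore] -/
def anti (A : ZdSepDualArmT ω n N lo hi lo' hi') {ω' : BondConfig (Site 2)} (h : ω' ⊆ ω) :
    ZdSepDualArmT ω' n N lo hi lo' hi' where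
  f := A.f
  g := A.g
  Q := A.Q
  hf := A.hf
  hg := A.hg
  hQc d hd hmem := A.hQc d hd (h hmem)
  hQa := A.hQa
  a := A.a
  b := A.b
  u := A.u
  C := A.C
  P := A.P
  hab := A.hab
  hC := A.hC
  hCc d hd hmem := A.hCc d hd (h hmem)
  hu := A.hu
  hP := A.hP
  hPc d hd hmem := A.hPc d hd (h hmem)
  a' := A.a'
  b' := A.b'
  u' := A.u'
  C' := A.C'
  P' := A.P'
  hab' := A.hab'
  hC' := A.hC'
  hC'c d hd hmem := A.hC'c d hd (h hmem)
  hu' := A.hu'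
  hP' := A.hP'
  hP'c d hd hmem := A.hP'c d hd (h hmem)

end ZdSepDualArmT

namespace ZdSepDualArmB

variable {ω : BondConfig (Site 2)} {n N : ℕ} {lo hi lo' hi' : ℤ}

/-- A fenced bottom dual arm of `ω` is a fenced bottom dual arm of every smaller configuration. [folklore] -/
def anti (A : ZdSepDualArmB ω n N lo hi lo' hi') {ω' : BondConfig (Site 2)} (h : ω' ⊆ ω) :
    ZdSepDualArmB ω' n N lo hi lo' hi' where
  f := A.f
  g := A.g
  Q := A.Q
  hf := A.hf
  hg := A.hg
  hQc d hd hmem := A.hQc d hd (h hmem)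
  hQa := A.hQa
  a := A.a
  b := A.b
  u := A.u
  C := A.C
  P := A.P
  hab := A.hab
  hC := A.hC
  hCc d hd hmem := A.hCc d hd (h hmem)
  hu := A.hu
  hP := A.hP
  hPc d hd hmem := A.hPc d hd (h hmem)
  a' := A.a'
  b' := A.b'
  u' := A.u'
  C' := A.C'
  P' := A.P'
  hab' := A.hab'
  hC' := A.hC'
  hC'c d hd hmem := A.hC'c d hd (h hmem)
  hu' := A.hu'
  hP' := A.hP'
  hP'c d hd hmem := A.hP'c d hd (h hmem)

end ZdSepDualArmB

/-- **The two fenced open arms landing on the right sides, vertex-disjoint**: `R⁺` with landing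
heights `[n/4, n/4 + n/64]` inside and `[N/4, N/4 + N/64]` outside, `R⁻` with the opposite
heights, and disjoint carriers (bodies, fences and attaching walks). (Kesten 1987, (2.26)–(2.28):
separated arms of one colour come from distinct crossing-clusters of the boundary strips.)
[cite: KestenScalingCMP1987, §2 (2.26)–(2.28), Lemma 4] [cite: Nolin2008, §4.2 (arXiv 0711.4948 Def. 6–8)] -/
def zdSepOpenPairR (n N : ℕ) : Set (BondConfig (Site 2)) :=
  {ω | ∃ (A : ZdSepOpenArmR ω n N (n / 4 : ℕ) ((n / 4 : ℕ) + (n / 64 : ℕ))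
      (N / 4 : ℕ) ((N / 4 : ℕ) + (N / 64 : ℕ)))
    (B : ZdSepOpenArmR ω n N (-((n / 4 : ℕ) + (n / 64 : ℕ) : ℤ)) (-(n / 4 : ℕ))
      (-((N / 4 : ℕ) + (N / 64 : ℕ) : ℤ)) (-(N / 4 : ℕ))),
    Disjoint A.carrier B.carrier}

/-- **The fenced open arm landing on the left sides**, landing heights `[0, n/64]` inside and
`[0, N/64]` outside. [cite: Nolin2008, §4.2 (arXiv 0711.4948 Def. 6–8)] -/
def zdSepOpenArmL (n N : ℕ) : Set (BondConfig (Site 2)) :=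
  {ω | Nonempty (ZdSepOpenArmL ω n N 0 (n / 64 : ℕ) 0 (N / 64 : ℕ))}

/-- **The fenced closed dual arm landing on the top sides**, landing columns `[0, n/64]` inside and
`[0, N/64]` outside. [cite: Nolin2008, §4.2 (arXiv 0711.4948 Def. 6–8)] -/
def zdSepDualArmT (n N : ℕ) : Set (BondConfig (Site 2)) :=
  {ω | Nonempty (ZdSepDualArmT ω n N 0 (n / 64 : ℕ) 0 (N / 64 : ℕ))}

/-- **The fenced closed dual arm landing on the bottom sides**, landing columns `[0, n/64]` inside
and `[0, N/64]` outside. [cite: Nolin2008, §4.2 (arXiv 0711.4948 Def. 6–8)] -/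
def zdSepDualArmB (n N : ℕ) : Set (BondConfig (Site 2)) :=
  {ω | Nonempty (ZdSepDualArmB ω n N 0 (n / 64 : ℕ) 0 (N / 64 : ℕ))}

/-- **Kesten's well-separated five-arm event** `𝒜̃₅(A_{n,N})` for bond percolation on `ℤ²` (Nolin's
`Ã̃^{η,I/η',I'}_{5,σ}(n,N)`, `σ = BWBBW`, `η = η' = 1/64`, with the landing sequences of the module
docstring): two vertex-disjoint fenced open arms to the right sides, a fenced open arm to the left
sides, fenced closed dual arms to the top and to the bottom sides — an increasing event meet a
decreasing one. [cite: Nolin2008, §4.2 (arXiv 0711.4948 Def. 6–8, the events Ã̃)] [cite: KestenScalingCMP1987, §2 (2.26)–(2.28)] -/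
def zdFiveArmSep (n N : ℕ) : Set (BondConfig (Site 2)) :=
  (zdSepOpenPairR n N ∩ zdSepOpenArmL n N) ∩ (zdSepDualArmT n N ∩ zdSepDualArmB n N)

/-! ### Monotonicity -/

/-- The right pair event is increasing. [folklore] -/
theorem isUpperSet_zdSepOpenPairR (n N : ℕ) : IsUpperSet (zdSepOpenPairR n N) := by
  rintro ω ω' hle ⟨A, B, hAB⟩
  exact ⟨A.mono hle, B.mono hle, by simpa using hAB⟩

/-- The left arm event is increasing. [folklore] -/
theorem isUpperSet_zdSepOpenArmL (n N : ℕ) : IsUpperSet (zdSepOpenArmL n N) := by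
  rintro ω ω' hle ⟨A⟩
  exact ⟨A.mono hle⟩

/-- The top dual arm event is decreasing. [folklore] -/
theorem isLowerSet_zdSepDualArmT (n N : ℕ) : IsLowerSet (zdSepDualArmT n N) := by
  rintro ω ω' hle ⟨A⟩
  exact ⟨A.anti hle⟩

/-- The bottom dual arm event is decreasing. [folklore] -/
theorem isLowerSet_zdSepDualArmB (n N : ℕ) : IsLowerSet (zdSepDualArmB n N) := by
  rintro ω ω' hle ⟨A⟩
  exact ⟨A.anti hle⟩

/-- The open part of the well-separated event is increasing. [folklore] -/
theorem isUpperSet_zdSepOpenPairR_inter_zdSepOpenArmL (n N : ℕ) :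
    IsUpperSet (zdSepOpenPairR n N ∩ zdSepOpenArmL n N) :=
  (isUpperSet_zdSepOpenPairR n N).inter (isUpperSet_zdSepOpenArmL n N)

/-- The dual part of the well-separated event is decreasing. [folklore] -/
theorem isLowerSet_zdSepDualArmT_inter_zdSepDualArmB (n N : ℕ) :
    IsLowerSet (zdSepDualArmT n N ∩ zdSepDualArmB n N) :=
  (isLowerSet_zdSepDualArmT n N).inter (isLowerSet_zdSepDualArmB n N)

/-! ### The well-separated event is a five-arm-type event: its open arms cross the annulus -/

/-- A site with `x₀ = ±m` and `|x₁| ≤ m` lies on the sup-norm sphere of radius `m ≥ 1`. [folklore] -/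
theorem mem_siteSphere_of_apply_zero {m : ℕ} (hm : 1 ≤ m) {x : Site 2}
    (h0 : x 0 = m ∨ x 0 = -(m : ℤ)) (h1 : |x 1| ≤ m) : x ∈ siteSphere m := by
  have hm1 : ((m - 1 : ℕ) : ℤ) = (m : ℤ) - 1 := by omega
  have h1' := abs_le.1 h1
  rw [siteSphere, Finset.mem_sdiff, mem_box, mem_box, Fin.forall_fin_two, Fin.forall_fin_two, hm1]
  constructor
  · rcases h0 with h0 | h0 <;> rw [h0] <;> refine ⟨⟨?_, ?_⟩, ?_, ?_⟩ <;> omega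
  · rintro ⟨⟨h00, h01⟩, -⟩
    rcases h0 with h0 | h0 <;> rw [h0] at h00 h01 <;> omega

/-- **The body of a fenced right arm is an open crossing of the annulus** (`64 ≤ n ≤ N`): it runs
inside `A_{n,N}` from a site of `{‖·‖_∞ = n}` to a site of `{‖·‖_∞ = N}`. [folklore] -/
theorem ZdSepOpenArmR.mem_sqAnnulusOpenCrossing {ω : BondConfig (Site 2)} {n N : ℕ}
    {lo hi lo' hi' : ℤ} (A : ZdSepOpenArmR ω n N lo hi lo' hi') (hn : 1 ≤ n) (hnN : n ≤ N)
    (hlo : -(n : ℤ) ≤ lo) (hhi : hi ≤ n) (hlo' : -(N : ℤ) ≤ lo') (hhi' : hi' ≤ N) :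
    ω ∈ sqAnnulusOpenCrossing n N := by
  refine ⟨A.x, mem_siteSphere_of_apply_zero hn (Or.inl A.hx.1) (abs_le.2 ⟨?_, ?_⟩), A.z,
    mem_siteSphere_of_apply_zero (hn.trans hnN) (Or.inl A.hz.1) (abs_le.2 ⟨?_, ?_⟩),
    mem_openConnIn_of_walk A.W A.hW A.hWo⟩
  · exact hlo.trans A.hx.2.1
  · exact A.hx.2.2.trans hhi
  · exact hlo'.trans A.hz.2.1
  · exact A.hz.2.2.trans hhi'

/-- **The well-separated event is contained in the one-arm (crossing) event** of the annulus, for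
`1 ≤ n ≤ N`. [folklore] -/
theorem zdFiveArmSep_subset_sqAnnulusOpenCrossing {n N : ℕ} (hn : 1 ≤ n) (hnN : n ≤ N) :
    zdFiveArmSep n N ⊆ sqAnnulusOpenCrossing n N := by
  rintro ω ⟨⟨⟨A, -, -⟩, -⟩, -⟩
  refine A.mem_sqAnnulusOpenCrossing hn hnN ?_ ?_ ?_ ?_ <;> push_cast <;> omega

end Literature.Probability.Percolation
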